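import Summits.KontsevichZagierPeriods.KontsevichZagierPeriods.Theorems.RootDecompRelativeModAbsoluteCylLogSplitP29

/-! # `RootDecompRelativeModAbsoluteCylLogSplitP30` — part 5/27 of the mechanical ≤400-line split of `RungClosure.lean` (sha256 f909f334226f0fb5…)
Source: decomp-kz lens-3 g12 `RungClosure.lean` v9 (HOME/decomp-kz-lens-3/g12/, sha256 f909f334…; critic g4-52/g4-57/g5 CLEARED, «lander: split v9 --supports 30572»): BLOCK I (57 g11 monolith decls missing from P01–P25), BLOCK II/III (WildCertAssembly parts 1–6, 8–10: `Leaf.cellLocalWildCert`, `Leaf.cylKernelZeroLog_of_trees`), Parts 12–13 (`Leaf.regKernelPairDegOne_iff_circlePos_of_trees`), BLOCK G13 (Möbius engine, test §C decided).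
Split by census-1 g9 `gen/splitlean.py`: scopes re-opened with their `open`/`variable`/`set_option` context; mathematics and declaration order unchanged. -/

noncomputable section
open Set MeasureTheory Filter Topology
open scoped BigOperators
open Literature.NumberTheory.Transcendental Literature.ModelTheory.ExponentialFields
namespace Summit.KontsevichZagierPeriods.RootDecompRelativeModAbsolute.Rung30571
namespace RegularisedLogLayer
namespace CylLog
variable {b : ℕ}

/-- **The wild closing engine.**  Data as in `tameClose` (a family of regularised log cells `P_i = [band_i, d_i (t−1)^{M_i}/t]` over one open semialgebraic base `G`, oriented by
`σ`), plus: a set `Z` of indices to be RAISED to the common order `m`, exact multiplicative relations `∏_i W_i^{g_{ri}} = 1` supported on `Z`, and a decomposition of the signed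
coefficients `(−1)^{M_i} d_i = Σ_r qq_r g_{ri} + Ñ_i` whose remainder `Ñ` satisfies the pointwise log identity and is TAME.  Every regularised cell the proof introduces is
certified honest by an explicit integrability hypothesis (raising: `hZpow`/`hZpow'`; splitting: `hqpow…hNpow'`; torus: `hL…hintV'`, stated over the padded edges `zW`; tameness of
the mixed family: `hNlog`/`hNtame`).  Conclusion identical to `tameClose`. -/
theorem wildClose
    (hBR : Summit.KontsevichZagierPeriods.LiouvilleUnfolding.LogPrimitiveNL.Negative.BoundaryRigidity)
    {b k a : ℕ} {G : Set (Fin b → ℝ)} (hGo : IsOpen G) (hG : IsSemialgebraic ℚ G) (d W : Fin k → (Fin b → ℝ) → ℝ) (M : Fin k → ℕ)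
    (hd : ∀ i, IsSemialgebraicFunOn ℚ G (d i)) (hW : ∀ i, IsSemialgebraicFunOn ℚ G (W i)) (hWd : ∀ i, DifferentiableOn ℝ (W i) G)
    (σ : Fin k → Bool) (hσt : ∀ i, σ i = true → ∀ x ∈ G, 1 ≤ W i x) (hσf : ∀ i, σ i = false → ∀ x ∈ G, 0 < W i x ∧ W i x ≤ 1)
    (Z : Fin k → Bool) (m : ℕ) (hMm : ∀ i, Z i = true → M i ≤ m) (g : Fin a → Fin k → ℤ) (hgZ : ∀ r i, Z i = false → g r i = 0) (hrel : ∀ r, ∀ x ∈ G, ∏ i, W i x ^ (g r i) = 1)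
    (qq : Fin a → (Fin b → ℝ) → ℝ) (hqq : ∀ r, IsSemialgebraicFunOn ℚ G (qq r)) (Nn : Fin k → (Fin b → ℝ) → ℝ) (hNn : ∀ i, IsSemialgebraicFunOn ℚ G (Nn i))
    (hcoef : ∀ i, ∀ x ∈ G, (-1) ^ M i * d i x = ∑ r, qq r x * (g r i : ℝ) + Nn i x) (hsumN : ∀ x ∈ G, ∑ i, Nn i x * Real.log (W i x) = 0)
    (hZpow : ∀ i, Z i = true → ∀ j, M i ≤ j → j ≤ m → IntegrableOn (fun x => d i x * (W i x - 1) ^ (j + 1)) G) (hZpow' : ∀ i, Z i = true → σ i = false → ∀ j, M i ≤ j → j ≤ m →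
      IntegrableOn (fun x => d i x * (1 - W i x) ^ (j + 1) / W i x) G) (hqpow : ∀ r i, Z i = true → IntegrableOn (fun x => qq r x * (W i x - 1) ^ (m + 1)) G)
    (hqpow' : ∀ r i, Z i = true → σ i = false → IntegrableOn (fun x => qq r x * (1 - W i x) ^ (m + 1) / W i x) G)
    (hNpow : ∀ i, Z i = true → IntegrableOn (fun x => Nn i x * (W i x - 1) ^ (m + 1)) G) (hNpow' : ∀ i, Z i = true → σ i = false →
      IntegrableOn (fun x => Nn i x * (1 - W i x) ^ (m + 1) / W i x) G) (hL : ∀ r, (∀ x ∈ G, 1 ≤ ∏ i, zW Z W i x ^ (g r i).toNat) ∨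
      (∀ x ∈ G, ∏ i, zW Z W i x ^ (g r i).toNat ≤ 1)) (hintU : ∀ r, IntegrableOn (fun x => qq r x * (∏ i, zW Z W i x ^ multUp (g r) σ i - 1) ^ (m + 1)) G)
    (hintU' : ∀ r, IntegrableOn (fun x => qq r x * (1 - ∏ i, zW Z W i x ^ multUp' (g r) σ i) ^ (m + 1) / ∏ i, zW Z W i x ^ multUp' (g r) σ i) G) (hintV : ∀ r, IntegrableOn
      (fun x => qq r x * (∏ i, zW Z W i x ^ multDn (g r) σ i - 1) ^ (m + 1)) G) (hintV' : ∀ r, IntegrableOn (fun x => qq r x *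
      (1 - ∏ i, zW Z W i x ^ multDn' (g r) σ i) ^ (m + 1) / ∏ i, zW Z W i x ^ multDn' (g r) σ i) G) (hNlog : ∀ i, IntegrableOn (fun x => Nn i x * Real.log (W i x)) G)
    (hNtame : ∀ i, σ i = true → ∀ j, j < (if Z i then m else M i) → IntegrableOn (fun x => Nn i x * (W i x - 1) ^ (j + 1)) G) (P : Fin k → KZ.IntegralRep (b + 1))
    (hPd : ∀ i, (P i).domain = if σ i then KZlog.band G (fun _ => 1) (W i) else KZlog.band G (W i) (fun _ => 1)) (hPi : ∀ i, EqOn (P i).integrand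
      (fun z => d i (Fin.init z) * ((z (Fin.last b) - 1) ^ M i / z (Fin.last b))) (P i).domain) (B : KZ.IntegralRep b) (hBd : B.domain = G)
    (hBi : EqOn B.integrand (fun x => ∑ i, d i x * polyLog (M i) (W i x)) G) : ∑ i, (if σ i then (1:ℤ) else -1) • KZ.of (P i) - KZ.of B ∈ KZ.relations := by
  classical
  have h1sa : IsSemialgebraicFunOn ℚ G (fun _ => (1:ℝ)) :=
    (isSemialgebraicFunOn_ratCast hG 1).congr fun _ _ => by simp
  have hGm : MeasurableSet G := hG.measurableSet_holds
  let ε : Fin k → ℤ := fun i => if σ i then 1 else -1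
  let Dom : Fin k → Set (Fin (b + 1) → ℝ) := fun i =>
    if σ i then KZlog.band G (fun _ => 1) (W i) else KZlog.band G (W i) (fun _ => 1)
  have hDom : ∀ i, (P i).domain = Dom i := hPd
  let mm : Fin k → ℕ := fun i => if Z i then m else M i
  have hMmm : ∀ i, M i ≤ mm i := fun i => by
    cases hz : Z i
    · simp [mm, hz]
    · simp only [mm, hz, if_true]; exact hMm i hz
  have hmmZ : ∀ i, Z i = true → mm i = m := fun i hz => by simp [mm, hz]
  have hmmN : ∀ i, Z i = false → mm i = M i := fun i hz => by simp [mm, hz]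
  have hW0 : ∀ i, ∀ x ∈ G, 0 < W i x := fun i x hx => by
    cases hσ : σ i
    · exact (hσf i hσ x hx).1
    · exact lt_of_lt_of_le one_pos (hσt i hσ x hx)
  have hWs : ∀ i, IsSemialgebraicFunOn ℚ G (fun x => W i x - 1) := fun i =>
    (IsSemialgebraicFunOn.sub_holds (hW i) h1sa).congr fun _ _ => by simp
  have hsgn : ∀ i, (-1:ℝ) ^ (mm i - M i) * (-1) ^ M i = (-1) ^ mm i := fun i => by
    rw [← pow_add, Nat.sub_add_cancel (hMmm i)]
  have hdi : ∀ i, ∀ x ∈ G, d i x = (-1) ^ M i * (∑ r, qq r x * (g r i : ℝ) + Nn i x) := fun i x hx => by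
    have h := hcoef i x hx
    have h2 : ((-1:ℝ) ^ M i) ^ 2 = 1 := by rw [← pow_mul, mul_comm, pow_mul]; simp
    linear_combination (-1:ℝ) ^ M i * h - d i x * h2
  have hdN : ∀ i, Z i = false → ∀ x ∈ G, (-1) ^ M i * d i x = Nn i x := fun i hz x hx => by
    rw [hcoef i x hx, Finset.sum_eq_zero (fun r _ => by rw [hgZ r i hz]; simp), zero_add]
  have hPj : ∀ i j, Z i = true → M i ≤ j → j ≤ m → ∃ R : KZ.IntegralRep (b + 1), R.domain = Dom i ∧
      R.integrand = fun z => d i (Fin.init z) * ((z (Fin.last b) - 1) ^ j / z (Fin.last b)) := by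
    intro i j hz hMj hjm
    cases hσ : σ i
    · obtain ⟨R, hRd, hRi⟩ := exists_regRep_of_integrableOn_pow' (m := j) hG (hd i) (hW i)
        (fun x hx => (hσf i hσ x hx).1) (fun x hx => (hσf i hσ x hx).2) (hZpow' i hz hσ j hMj hjm)
      exact ⟨R, by simp [Dom, hσ, hRd], hRi⟩
    · obtain ⟨R, hRd, hRi⟩ := exists_regRep_of_integrableOn_pow (m := j) hG (hd i) (hW i) (hσt i hσ)
        (hZpow i hz j hMj hjm)
      exact ⟨R, by simp [Dom, hσ, hRd], hRi⟩
  let P' : Fin k → ℕ → KZ.IntegralRep (b + 1) := fun i j =>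
    if h : Z i = true ∧ M i < j ∧ j ≤ m then (hPj i j h.1 h.2.1.le h.2.2).choose else P i
  have hP'd : ∀ i j, M i ≤ j → j ≤ mm i → (P' i j).domain = Dom i := by
    intro i j hMj hjm
    by_cases h : Z i = true ∧ M i < j ∧ j ≤ m
    · simp only [P', dif_pos h]
      exact (hPj i j h.1 h.2.1.le h.2.2).choose_spec.1
    · simp only [P', dif_neg h]
      exact hDom i
  have hP'i : ∀ i j, M i ≤ j → j ≤ mm i → EqOn (P' i j).integrand
      (fun z => d i (Fin.init z) * ((z (Fin.last b) - 1) ^ j / z (Fin.last b))) (P' i j).domain := by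
    intro i j hMj hjm
    by_cases h : Z i = true ∧ M i < j ∧ j ≤ m
    · simp only [P', dif_pos h]
      rw [(hPj i j h.1 h.2.1.le h.2.2).choose_spec.2]
      exact fun _ _ => rfl
    · simp only [P', dif_neg h]
      have hjM : j = M i := by
        by_contra hne
        have hlt : M i < j := lt_of_le_of_ne hMj (Ne.symm hne)
        cases hz : Z i
        · exact absurd (hmmN i hz ▸ hjm) (not_le.mpr hlt)
        · exact h ⟨hz, hlt, hmmZ i hz ▸ hjm⟩
      rw [hjM]
      exact hPi i
  have hP'bot : ∀ i, P' i (M i) = P i := fun i => by simp [P']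
  let Ft : Fin k → ℕ → (Fin b → ℝ) → ℝ := fun i j x =>
    ((ε i : ℤ) : ℝ) * ((j : ℝ) + 1)⁻¹ * (d i x * (W i x - 1) ^ (j + 1))
  have hFt : ∀ i j, IsSemialgebraicFunOn ℚ G (Ft i j) := fun i j =>
    (IsSemialgebraicFunOn.mul_holds (isSemialgebraicFunOn_ratCast hG ((ε i : ℚ) * ((j : ℚ) + 1)⁻¹))
      (IsSemialgebraicFunOn.mul_holds (hd i) (isSemialgebraicFunOn_pow' hG (hWs i) (j + 1)))).congr
      fun x _ => by simp only [Ft, Pi.mul_apply]; push_cast; ring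
  have hFti : ∀ i j, M i ≤ j → j < mm i → IntegrableOn (Ft i j) G := by
    intro i j hMj hjm
    have hz : Z i = true := by
      cases hz : Z i
      · exact absurd (hmmN i hz ▸ hjm) (not_lt.mpr hMj)
      · rfl
    exact IntegrableOn.congr_fun ((hZpow i hz j hMj (hmmZ i hz ▸ hjm).le).const_mul
      (((ε i : ℤ) : ℝ) * ((j : ℝ) + 1)⁻¹)) (fun x _ => by simp only [Ft]) hGm
  have hBt : ∀ i j, M i ≤ j → j < mm i → ∃ Bb : KZ.IntegralRep b, Bb.domain = G ∧ Bb.integrand = Ft i j :=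
    fun i j hMj hjm => exists_baseRep_of_integrableOn hG (hFt i j) (hFti i j hMj hjm)
  let Bt : Fin k → ℕ → KZ.IntegralRep b := fun i j =>
    if h : M i ≤ j ∧ j < mm i then (hBt i j h.1 h.2).choose else B
  have hBtd : ∀ i j, M i ≤ j → j < mm i → (Bt i j).domain = G := fun i j h1 h2 => by
    simp only [Bt, dif_pos (And.intro h1 h2)]; exact (hBt i j h1 h2).choose_spec.1
  have hBti : ∀ i j, M i ≤ j → j < mm i → (Bt i j).integrand = Ft i j := fun i j h1 h2 => by
    simp only [Bt, dif_pos (And.intro h1 h2)]; exact (hBt i j h1 h2).choose_spec.2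
  have hT : ∀ i, KZ.of (P i) - ((-1:ℤ) ^ (mm i - M i) • KZ.of (P' i (mm i)) +
      ∑ j ∈ Finset.Ico (M i) (mm i), (-1:ℤ) ^ (j - M i) • KZ.of (Bt i j)) ∈ KZ.relations := by
    intro i
    cases hσ : σ i
    · -- reversed band `[W_i, 1]`
      have h := regOrder_telescope (M := M i) (m := mm i) (hMmm i) (c := d i) (p := W i) (q := fun _ => 1)
        (hd i) (hW i) h1sa (fun x hx => (hσf i hσ x hx).1) (fun x hx => (hσf i hσ x hx).2) (P' i) (Bt i)
        (fun j h1 h2 => by rw [hP'd i j h1 h2]; simp [Dom, hσ]) (fun j h1 h2 => hP'i i j h1 h2)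
        (fun j h1 h2 => hBtd i j h1 h2)
        (fun j h1 h2 x _ => by rw [hBti i j h1 h2]; simp only [Ft, ε, hσ]; push_cast; simp; ring)
      simpa only [hP'bot] using h
    · -- band `[1, W_i]`
      have h := regOrder_telescope (M := M i) (m := mm i) (hMmm i) (c := d i) (p := fun _ => 1) (q := W i)
        (hd i) h1sa (hW i) (fun _ _ => one_pos) (hσt i hσ) (P' i) (Bt i)
        (fun j h1 h2 => by rw [hP'd i j h1 h2]; simp [Dom, hσ]) (fun j h1 h2 => hP'i i j h1 h2)
        (fun j h1 h2 => hBtd i j h1 h2)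
        (fun j h1 h2 x _ => by rw [hBti i j h1 h2]; simp only [Ft, ε, hσ]; push_cast; simp; ring)
      simpa only [hP'bot] using h
  let dq : Fin a → (Fin b → ℝ) → ℝ := fun r x => (-1) ^ m * qq r x
  have hdq : ∀ r, IsSemialgebraicFunOn ℚ G (dq r) := fun r =>
    (IsSemialgebraicFunOn.mul_holds (isSemialgebraicFunOn_ratCast hG ((-1) ^ m)) (hqq r)).congr
      fun x _ => by simp only [dq, Pi.mul_apply]; push_cast; ring
  have hRr : ∀ r i, ∃ R : KZ.IntegralRep (b + 1),
      R.domain = (if σ i then KZlog.band G (fun _ => 1) (zW Z W i) else KZlog.band G (zW Z W i) (fun _ => 1)) ∧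
      R.integrand = fun z => dq r (Fin.init z) * ((z (Fin.last b) - 1) ^ m / z (Fin.last b)) := by
    intro r i
    cases hz : Z i
    · obtain ⟨R, hRd, hRi⟩ := exists_nullBandRep m hG (hdq r)
      refine ⟨R, ?_, hRi⟩
      rw [hRd, zW_of_false hz]; cases σ i <;> simp
    · rw [zW_of_true hz]
      cases hσ : σ i
      · obtain ⟨R, hRd, hRi⟩ := exists_regRep_of_integrableOn_pow' (m := m) hG (hdq r) (hW i)
          (fun x hx => (hσf i hσ x hx).1) (fun x hx => (hσf i hσ x hx).2)
          (IntegrableOn.congr_fun ((hqpow' r i hz hσ).const_mul ((-1:ℝ) ^ m)) (fun x _ => by simp only [dq]; ring) hGm)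
        exact ⟨R, by simp [hRd], hRi⟩
      · obtain ⟨R, hRd, hRi⟩ := exists_regRep_of_integrableOn_pow (m := m) hG (hdq r) (hW i) (hσt i hσ)
          (IntegrableOn.congr_fun ((hqpow r i hz).const_mul ((-1:ℝ) ^ m)) (fun x _ => by simp only [dq]; ring) hGm)
        exact ⟨R, by simp [hRd], hRi⟩
  choose Rr hRrd hRri using hRr
  have hRrdZ : ∀ r i, Z i = true → (Rr r i).domain = Dom i := fun r i hz => by
    rw [hRrd r i, zW_of_true hz]
  let D : Fin k → (Fin b → ℝ) → ℝ := fun i x => (-1) ^ mm i * Nn i x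
  have hD : ∀ i, IsSemialgebraicFunOn ℚ G (D i) := fun i =>
    (IsSemialgebraicFunOn.mul_holds (isSemialgebraicFunOn_ratCast hG ((-1) ^ mm i)) (hNn i)).congr
      fun x _ => by simp only [D, Pi.mul_apply]; push_cast; ring
  have hDN : ∀ i, Z i = false → ∀ x ∈ G, D i x = d i x := fun i hz x hx => by
    simp only [D, hmmN i hz]
    rw [← hdN i hz x hx, ← mul_assoc, ← pow_add, ← two_mul, pow_mul]
    simp
  have hQex : ∀ i, ∃ Q : KZ.IntegralRep (b + 1), Q.domain = Dom i ∧
      EqOn Q.integrand (fun z => D i (Fin.init z) * ((z (Fin.last b) - 1) ^ mm i / z (Fin.last b))) Q.domain ∧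
      (Z i = false → Q = P i) := by
    intro i
    cases hz : Z i
    · refine ⟨P i, hDom i, fun z hz' => ?_, fun _ => rfl⟩
      have hxG : Fin.init z ∈ G := by
        have h' := hz'; rw [hDom i] at h'
        cases hσ : σ i
        · simp only [Dom, hσ] at h'; exact h'.1
        · simp only [Dom, hσ, if_true] at h'; exact h'.1
      simp only [hPi i hz', hmmN i hz, hDN i hz _ hxG]
    · rw [hmmZ i hz]
      cases hσ : σ i
      · obtain ⟨R, hRd, hRi⟩ := exists_regRep_of_integrableOn_pow' (m := m) hG (hD i) (hW i)
          (fun x hx => (hσf i hσ x hx).1) (fun x hx => (hσf i hσ x hx).2)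
          (IntegrableOn.congr_fun ((hNpow' i hz hσ).const_mul ((-1:ℝ) ^ mm i)) (fun x _ => by simp only [D]; ring) hGm)
        exact ⟨R, by simp [Dom, hσ, hRd], fun z _ => by rw [hRi], fun h => absurd h (by simp)⟩
      · obtain ⟨R, hRd, hRi⟩ := exists_regRep_of_integrableOn_pow (m := m) hG (hD i) (hW i) (hσt i hσ)
          (IntegrableOn.congr_fun ((hNpow i hz).const_mul ((-1:ℝ) ^ mm i)) (fun x _ => by simp only [D]; ring) hGm)
        exact ⟨R, by simp [Dom, hσ, hRd], fun z _ => by rw [hRi], fun h => absurd h (by simp)⟩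
  choose Q hQd hQi hQN using hQex
  have hS : ∀ i, KZ.of (Q i) - (-1:ℤ) ^ (mm i - M i) • KZ.of (P' i (mm i)) +
      ∑ r, g r i • KZ.of (Rr r i) ∈ KZ.relations := by
    intro i; cases hz : Z i
    · -- off `Z`: `Q_i = P_i = P'_i (M_i)` and every `g_ri = 0`
      have h0 : ∑ r, g r i • KZ.of (Rr r i) = 0 :=
        Finset.sum_eq_zero fun r _ => by rw [hgZ r i hz, zero_smul]
      rw [h0, add_zero, hQN i hz, hmmN i hz, Nat.sub_self, pow_zero, one_smul, hP'bot, sub_self]; exact KZ.relations.zero_mem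
    · have hs := hsgn i
      rw [hmmZ i hz] at hs
      have h := of_sub_sum_zsmul_mem_relations (Finset.univ : Finset (Option (Fin a)))
        (fun o => o.elim (P' i (mm i)) (fun r => Rr r i))
        (fun o => o.elim ((-1:ℤ) ^ (mm i - M i)) (fun r => -g r i)) (Q i)
        (fun o _ => by
          cases o with
          | none => show (P' i (mm i)).domain = _; rw [hP'd i (mm i) (hMmm i) le_rfl, hQd]
          | some r => show (Rr r i).domain = _; rw [hRrdZ r i hz, hQd])
        (fun z hz' => by
          have hzD : z ∈ Dom i := hQd i ▸ hz'
          have hxG : Fin.init z ∈ G := by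
            cases hσ : σ i
            · simp only [Dom, hσ] at hzD; exact hzD.1
            · simp only [Dom, hσ, if_true] at hzD; exact hzD.1
          have eP : (P' i (mm i)).integrand z =
              d i (Fin.init z) * ((z (Fin.last b) - 1) ^ m / z (Fin.last b)) := by
            rw [hP'i i (mm i) (hMmm i) le_rfl (by rw [hP'd i (mm i) (hMmm i) le_rfl]; exact hzD), hmmZ i hz]
          have eQ : (Q i).integrand z =
              (-1) ^ m * Nn i (Fin.init z) * ((z (Fin.last b) - 1) ^ m / z (Fin.last b)) := by
            rw [hQi i hz']; simp only [D, hmmZ i hz]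
          have eR : ∀ r, (Rr r i).integrand z =
              (-1) ^ m * qq r (Fin.init z) * ((z (Fin.last b) - 1) ^ m / z (Fin.last b)) := fun r => by
            rw [hRri r i]
          simp only [Fintype.sum_option, Option.elim, eP, eQ, eR]; rw [hmmZ i hz, hdi i _ hxG]; push_cast
          have eS : ∑ r, -(g r i : ℝ) * ((-1) ^ m * qq r (Fin.init z) *
              ((z (Fin.last b) - 1) ^ m / z (Fin.last b))) =
              -((-1) ^ m * ((z (Fin.last b) - 1) ^ m / z (Fin.last b))) *
                ∑ r, qq r (Fin.init z) * (g r i : ℝ) := by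
            rw [Finset.mul_sum]; exact Finset.sum_congr rfl fun r _ => by ring
          rw [eS, ← hs]
          ring)
      simpa only [Fintype.sum_option, Option.elim, neg_smul, Finset.sum_neg_distrib, sub_neg_eq_add,
        ← sub_sub] using h
  have hzW : ∀ i, IsSemialgebraicFunOn ℚ G (zW Z W i) := fun i => by
    cases hz : Z i
    · rw [zW_of_false hz]; exact h1sa
    · rw [zW_of_true hz]; exact hW i
  have hzWd : ∀ i, DifferentiableOn ℝ (zW Z W i) G := fun i => by
    cases hz : Z i
    · rw [zW_of_false hz]; exact differentiableOn_const _
    · rw [zW_of_true hz]; exact hWd i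
  have hzσt : ∀ i, σ i = true → ∀ x ∈ G, 1 ≤ zW Z W i x := fun i hσ x hx => by
    cases hz : Z i
    · rw [zW_of_false hz]
    · rw [zW_of_true hz]; exact hσt i hσ x hx
  have hzσf : ∀ i, σ i = false → ∀ x ∈ G, 0 < zW Z W i x ∧ zW Z W i x ≤ 1 := fun i hσ x hx => by
    cases hz : Z i
    · rw [zW_of_false hz]; exact ⟨one_pos, le_rfl⟩
    · rw [zW_of_true hz]; exact hσf i hσ x hx
  have hzrel : ∀ r, ∀ x ∈ G, ∏ i, zW Z W i x ^ (g r i) = 1 := fun r x hx => by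
    rw [← hrel r x hx]; refine Finset.prod_congr rfl fun i _ => ?_
    cases hz : Z i
    · rw [zW_of_false hz, hgZ r i hz]; simp
    · rw [zW_of_true hz]
  have hR : ∀ r, ∃ Br : KZ.IntegralRep b, Br.domain = G ∧
      (Br.integrand = fun x => dq r x * ∑ i, (g r i : ℝ) * polyLog m (zW Z W i x)) ∧
      ∑ i, (if σ i then g r i else -g r i) • KZ.of (Rr r i) - KZ.of Br ∈ KZ.relations := fun r =>
    regCells_mem_relations_of_zpow_rel (m := m) hGo hG (hdq r) (zW Z W) hzW hzWd σ hzσt hzσf (g r)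
      (hzrel r) (hL r)
      (IntegrableOn.congr_fun ((hintU r).const_mul ((-1:ℝ) ^ m)) (fun x _ => by simp only [dq]; ring) hGm)
      (IntegrableOn.congr_fun ((hintU' r).const_mul ((-1:ℝ) ^ m)) (fun x _ => by simp only [dq]; ring) hGm)
      (IntegrableOn.congr_fun ((hintV r).const_mul ((-1:ℝ) ^ m)) (fun x _ => by simp only [dq]; ring) hGm)
      (IntegrableOn.congr_fun ((hintV' r).const_mul ((-1:ℝ) ^ m)) (fun x _ => by simp only [dq]; ring) hGm)
      (fun i => Rr r i) (fun i => hRrd r i) (fun i => by rw [hRri r i]; exact fun _ _ => rfl)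
  choose Br hBrd hBri hBrR using hR
  have hBrR' : ∀ r, ∑ i, (ε i * g r i) • KZ.of (Rr r i) - KZ.of (Br r) ∈ KZ.relations := fun r => by
    convert hBrR r using 3 with i
    simp only [ε]; cases σ i <;> simp
  have hDlog : ∀ i, IntegrableOn (fun x => D i x * Real.log (W i x)) G := fun i =>
    IntegrableOn.congr_fun ((hNlog i).const_mul ((-1:ℝ) ^ mm i)) (fun x _ => by simp only [D]; ring) hGm
  have hDpow : ∀ i, σ i = true → ∀ j, j < mm i →
      IntegrableOn (fun x => D i x * (W i x - 1) ^ (j + 1)) G := fun i hσ j hj =>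
    IntegrableOn.congr_fun ((hNtame i hσ j hj).const_mul ((-1:ℝ) ^ mm i))
      (fun x _ => by simp only [D]; ring) hGm
  have hDsum : ∀ x ∈ G, ∑ i, (-1) ^ mm i * D i x * Real.log (W i x) = 0 := fun x hx => by
    rw [← hsumN x hx]; refine Finset.sum_congr rfl fun i _ => ?_
    simp only [D]; rw [← mul_assoc, ← pow_add, ← two_mul, pow_mul]
    simp
  let S : Finset (Σ _ : Fin k, ℕ) := Finset.univ.sigma fun i => Finset.Ico (M i) (mm i)
  let cc : (Σ _ : Fin k, ℕ) → ℤ := fun p => ε p.1 * (-1) ^ (p.2 - M p.1)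
  have hSmem : ∀ p ∈ S, M p.1 ≤ p.2 ∧ p.2 < mm p.1 := fun p hp => by
    have h := (Finset.mem_sigma.mp hp).2; exact Finset.mem_Ico.mp h
  let Fs : (Fin b → ℝ) → ℝ := fun x => ∑ r, (Br r).integrand x + ∑ p ∈ S, (cc p : ℝ) * (Bt p.1 p.2).integrand x
  have hBrsa : ∀ r, IsSemialgebraicFunOn ℚ G (Br r).integrand := fun r => by
    rw [← hBrd r]; exact (Br r).isSemialgebraicFunOn_integrand
  have hBrint : ∀ r, IntegrableOn (Br r).integrand G := fun r => by
    rw [← hBrd r]; exact (Br r).integrableOn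
  have hBtsa : ∀ p ∈ S, IsSemialgebraicFunOn ℚ G (Bt p.1 p.2).integrand := fun p hp => by
    rw [← hBtd p.1 p.2 (hSmem p hp).1 (hSmem p hp).2]; exact (Bt p.1 p.2).isSemialgebraicFunOn_integrand
  have hBtint : ∀ p ∈ S, IntegrableOn (Bt p.1 p.2).integrand G := fun p hp => by
    rw [← hBtd p.1 p.2 (hSmem p hp).1 (hSmem p hp).2]; exact (Bt p.1 p.2).integrableOn
  have hFs : IsSemialgebraicFunOn ℚ G Fs :=
    IsSemialgebraicFunOn.add_holds (KZ.isSemialgebraicFunOn_finset_sum Finset.univ hG fun r _ => hBrsa r)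
      (KZ.isSemialgebraicFunOn_finset_sum S hG fun p hp =>
        (IsSemialgebraicFunOn.mul_holds (isSemialgebraicFunOn_ratCast hG (cc p : ℚ)) (hBtsa p hp)).congr
          fun x _ => by simp only [Pi.mul_apply]; push_cast; ring)
  have hFsi : IntegrableOn Fs G :=
    (integrable_finsetSum Finset.univ fun r _ => hBrint r).add
      (integrable_finsetSum S fun p hp => (hBtint p hp).const_mul _)
  obtain ⟨Bs, hBsd, hBsi⟩ := exists_baseRep_of_integrableOn hG hFs hFsi
  have hBint : IntegrableOn B.integrand G := hBd ▸ B.integrableOn; have hBsa : IsSemialgebraicFunOn ℚ G B.integrand := hBd ▸ B.isSemialgebraicFunOn_integrand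
  obtain ⟨BT, hBTd, hBTi⟩ := exists_baseRep_of_integrableOn hG
    (F := fun x => B.integrand x - Fs x)
    ((IsSemialgebraicFunOn.sub_holds hBsa hFs).congr fun x _ => by simp)
    (hBint.sub hFsi)
  have hper : ∀ x ∈ G, ∀ i, d i x * polyLog (M i) (W i x) = D i x * polyLog (mm i) (W i x) +
      ∑ r, dq r x * ((g r i : ℝ) * polyLog m (zW Z W i x)) +
      ∑ j ∈ Finset.Ico (M i) (mm i), (cc ⟨i, j⟩ : ℝ) * (Bt i j).integrand x := by
    intro x hx i
    have hε2 : ((ε i : ℤ) : ℝ) ^ 2 = 1 := by simp only [ε]; cases σ i <;> simp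
    cases hz : Z i
    · -- off `Z`
      rw [hmmN i hz, zW_of_false hz, Finset.Ico_self, Finset.sum_empty, add_zero]; simp only [polyLog_one, mul_zero, Finset.sum_const_zero, add_zero]; rw [hDN i hz x hx]
    · -- on `Z`: the `polyLog` telescope
      have hs := hsgn i; rw [hmmZ i hz] at hs; rw [zW_of_true hz, hmmZ i hz, polyLog_telescope (hMm i hz) (W i x)]
      have eBt : ∑ j ∈ Finset.Ico (M i) m, (cc ⟨i, j⟩ : ℝ) * (Bt i j).integrand x =
          d i x * ∑ j ∈ Finset.Ico (M i) m, (-1:ℝ) ^ (j - M i) * ((W i x - 1) ^ (j + 1) / (j + 1)) := by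
        rw [Finset.mul_sum]; refine Finset.sum_congr rfl fun j hj => ?_
        have hj' := Finset.mem_Ico.mp hj; rw [hBti i j hj'.1 (by rw [hmmZ i hz]; exact hj'.2)]
        simp only [cc, Ft]; push_cast; linear_combination ((-1:ℝ) ^ (j - M i) * ((j:ℝ) + 1)⁻¹ * d i x * (W i x - 1) ^ (j + 1)) * hε2
      have eR : ∑ r, dq r x * ((g r i : ℝ) * polyLog m (W i x)) =
          (-1) ^ m * polyLog m (W i x) * ∑ r, qq r x * (g r i : ℝ) := by
        rw [Finset.mul_sum]; exact Finset.sum_congr rfl fun r _ => by simp only [dq]; ring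
      rw [eBt, eR]; simp only [D, hmmZ i hz]; rw [hdi i x hx, ← hs]; ring
  have hBTeq : EqOn BT.integrand (fun x => ∑ i, D i x * polyLog (mm i) (W i x)) G := by
    intro x hx; rw [hBTi]; show B.integrand x - Fs x = ∑ i, D i x * polyLog (mm i) (W i x)
    have eFs : Fs x = ∑ i, (∑ r, dq r x * ((g r i : ℝ) * polyLog m (zW Z W i x)) +
        ∑ j ∈ Finset.Ico (M i) (mm i), (cc ⟨i, j⟩ : ℝ) * (Bt i j).integrand x) := by
      simp only [Fs]; rw [Finset.sum_add_distrib]; congr 1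
      · rw [Finset.sum_comm]
        exact Finset.sum_congr rfl fun r _ => by simp only [hBri r, Finset.mul_sum]
      · exact Finset.sum_sigma _ _ _
    rw [hBi hx, eFs, ← Finset.sum_sub_distrib]; refine Finset.sum_congr rfl fun i _ => ?_
    rw [hper x hx i]; ring
  have hTC : ∑ i, ε i • KZ.of (Q i) - KZ.of BT ∈ KZ.relations :=
    tameClose hBR hGo hG D W mm hD hW hWd σ hσt hσf hDlog hDpow hDsum Q
      (fun i => by rw [hQd i]) hQi BT hBTd hBTeq
  have hB1 : KZ.of Bs - (∑ r, KZ.of (Br r) + ∑ p ∈ S, cc p • KZ.of (Bt p.1 p.2)) ∈ KZ.relations := by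
    have h := of_sub_sum_zsmul_mem_relations (Finset.disjSum (Finset.univ : Finset (Fin a)) S)
      (fun o => Sum.elim (fun r => Br r) (fun p => Bt p.1 p.2) o)
      (fun o => Sum.elim (fun _ => (1:ℤ)) cc o) Bs
      (fun o ho => by
        rcases Finset.mem_disjSum.mp ho with ⟨r, _, rfl⟩ | ⟨p, hp, rfl⟩
        · show (Br r).domain = _; rw [hBrd r, hBsd]
        · show (Bt p.1 p.2).domain = _; rw [hBtd p.1 p.2 (hSmem p hp).1 (hSmem p hp).2, hBsd])
      (fun x hx => by
        rw [hBsi]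
        simp only [Fs, Finset.sum_disjSum, Sum.elim_inl, Sum.elim_inr, Int.cast_one, one_mul])
    simpa only [Finset.sum_disjSum, Sum.elim_inl, Sum.elim_inr, one_smul] using h
  have hB2 : KZ.of B - KZ.of BT - KZ.of Bs ∈ KZ.relations := by
    have h := KZ.of_sub_of_sub_sum_mem_relations 1 B BT (fun _ => Bs) (by rw [hBTd, hBd])
      (fun _ => by rw [hBsd, hBd]) (fun x hx => by
        show B.integrand x = BT.integrand x + ∑ _l : Fin 1, Bs.integrand x
        rw [Fin.sum_univ_one, hBTi, hBsi]; show _ = B.integrand x - Fs x + Fs x; ring)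
    simpa only [Fin.sum_univ_one] using h
  have hE : ∀ i, ε i • KZ.of (P i) - ε i • KZ.of (Q i) - ∑ r, (ε i * g r i) • KZ.of (Rr r i) -
      ∑ j ∈ Finset.Ico (M i) (mm i), cc ⟨i, j⟩ • KZ.of (Bt i j) ∈ KZ.relations := by
    intro i
    have h12 := KZ.relations.add_mem (KZ.relations.zsmul_mem (hT i) (ε i))
      (KZ.relations.zsmul_mem (hS i) (-ε i))
    convert h12 using 1
    simp only [cc, smul_sub, smul_add, Finset.smul_sum, smul_smul, neg_mul, neg_smul,
      Finset.sum_neg_distrib]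
    abel
  have hEs := sum_mem fun i (_ : i ∈ (Finset.univ : Finset (Fin k))) => hE i
  have hEs' : ∑ i, ε i • KZ.of (P i) - ∑ i, ε i • KZ.of (Q i) - ∑ r, ∑ i, (ε i * g r i) • KZ.of (Rr r i) -
      ∑ p ∈ S, cc p • KZ.of (Bt p.1 p.2) ∈ KZ.relations := by
    have h := hEs; simp only [Finset.sum_sub_distrib] at h; rw [Finset.sum_comm] at h; simpa only [S, Finset.sum_sigma] using h
  have hRs := sum_mem fun r (_ : r ∈ (Finset.univ : Finset (Fin a))) => hBrR' r
  have hRs' : ∑ r, ∑ i, (ε i * g r i) • KZ.of (Rr r i) - ∑ r, KZ.of (Br r) ∈ KZ.relations := by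
    simpa only [Finset.sum_sub_distrib] using hRs
  have key : ∑ i, ε i • KZ.of (P i) - KZ.of B =
      (∑ i, ε i • KZ.of (P i) - ∑ i, ε i • KZ.of (Q i) - ∑ r, ∑ i, (ε i * g r i) • KZ.of (Rr r i) -
        ∑ p ∈ S, cc p • KZ.of (Bt p.1 p.2)) +
      (∑ i, ε i • KZ.of (Q i) - KZ.of BT) +
      (∑ r, ∑ i, (ε i * g r i) • KZ.of (Rr r i) - ∑ r, KZ.of (Br r)) -
      (KZ.of Bs - (∑ r, KZ.of (Br r) + ∑ p ∈ S, cc p • KZ.of (Bt p.1 p.2))) -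
      (KZ.of B - KZ.of BT - KZ.of Bs) := by
    abel
  rw [key]
  exact KZ.relations.sub_mem (KZ.relations.sub_mem
    (KZ.relations.add_mem (KZ.relations.add_mem hEs' hTC) hRs') hB1) hB2

end CylLog
end RegularisedLogLayer
end Summit.KontsevichZagierPeriods.RootDecompRelativeModAbsolute.Rung30571
end
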